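import Summits.QuantumFields.GaugeBoot.DiagonalRPTorusBandValue
import Summits.QuantumFields.GaugeBoot.DiagonalRPTorusNegativeOddSUN
import Summits.QuantumFields.GaugeBoot.DiagonalRPTorusInnerHalfNegativeEven
import HarnessLib

/-!
# Inner-half diagonal RP fails on even three-tori for `G ≅ SU(N)` at small coupling
(gauge-boot, task L3(π), main file, 7/7)

HONEST FRAMING (cell `pub-gaugeboot`, page 1 of every file): the venture produces certified bounds
on lattice expectations at stated coupling, gauge group, dimension and torus size; NOT a mass gap,
NOT a continuum limit, NOT a string tension; NOT Yang–Mills-summit-bearing (barriers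
`FixedCouplingUltralocality`, `PerturbativeInvisibility`). This module is a structural NEGATIVE
result about which positivity constraints a TORUS certificate may use; it discharges nothing else.

## Content

`DiagonalRPTorusNegativeOddSUN` (L3(ξ)) refutes the torus transplant of CLOSED-half diagonal RP
on every ODD three-torus for `G ≅ SU(N)` at small coupling; on EVEN tori the closed half fails
trivially (back layer, `not_diagonalReflectionPositive`) and the meaningful statement is the
INNER-half one, `InnerDiagonalRP` (`DiagonalRPTorusInnerHalf`), true on every even two-torus
`L ≥ 4` (L3(η)) and refuted on every even three-torus `L ≥ 6` for sign-character groups only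
(`DiagRPThree.not_innerDiagonalRP_even`, L3(ν)). Here the `SU(N)` case: the Polyakov-loop
witness of L3(ν), `F = P_X - P_Y`, `X = (c-1, 0)`, `Y = (-2, c-1)`, `L = 2c ≥ 6`, strictly
inside the half, run through the small-`β` cluster expansion with the first two Haar moments of
the fundamental character. The cross pairs `(θX, Y)`, `(θY, X)` are columns at distance TWO
(common neighbour `θX - e₀`, resp. `θY + e₁`); the diagonal pairs are separated (both
coordinate differences `∉ {0, ±1}`).

* `rpForm_le_even` — for `ρ z₀ = ω • 1` (`ω ≠ 1`), `0 ≤ β`, `2βN ≤ 1`: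
  `RP form ≤ -β^{2L} (J₁ + J₂) + C β^{2L+1}` with the two BAND INTEGRALS `J₁, J₂ > 0`
  (`DiagRPSUN.bandIntegral_pos`: `J = c₁^L · c₁^{L-1} c₂ (V₀² + V₁²)`); below order `2L + 1`
  every cluster term other than the two bands vanishes — a minimal cover of two non-adjacent
  columns that is not a band has a LONELY LINK (`DiagonalRPTorusFins`), and a lonely link
  integrates its plaquette to a constant, uncovering a column (`DiagonalRPTorusLonelyLink`,
  `DiagonalRPTorusBandTerm`);
* `isInnerHalfObservable_polReDiff_even` — the witness is an inner-half observable;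
* **`not_innerDiagonalRP_even_of_moments`** — every compact metrisable `G`, continuous `ρ`
  (`N ≥ 1`) with a centre element and the character identities (R1), (R2) (`c₁, c₂ > 0`):
  for every even `L ≥ 6` there is `β₀ > 0` with `¬ InnerDiagonalRP (d := 3) (L := L) ρ β 0 1`
  for all `0 < β ≤ β₀`;
* **`not_innerDiagonalRP_even_specialUnitary`** (`G ≅ SU(N)`, `N ≥ 2`) and
  **`not_innerDiagonalRP_even_suN`** (`Matrix.specialUnitaryGroup (Fin N) ℂ`, not vacuous);
  `not_backInvariantDiagonalRP_even_suN` — the back-gauge-invariant form fails too.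

Together with L3(ξ): for the venture's own gauge groups the finite-torus transplants of diagonal RP
fail on EVERY three-torus `L ≥ 5` (closed half on odd `L`, inner half on even `L`) at small
coupling `β ≤ β₀(L, N)` (existential, not uniform in `L`). MEANING (one sentence): the
two-dimensional route to Class B through inner-half diagonal RP of even tori (L3(ι)) has no
three-dimensional analogue for `SU(2)`, `SU(3)` either. Elementary strong-coupling expansion; not
in print as far as the cell's searches go.
-/

open MeasureTheory Complex Finset Function
open scoped ComplexOrder

namespace Summit.QuantumFields.GaugeBoot

open Literature.MathematicalPhysics.QuantumFieldTheory
open Literature.MathematicalPhysics.QuantumFieldTheory.PlaquetteLowerBound (reTr)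
open Literature.RepresentationTheory.CompactGroups

noncomputable section

namespace DiagRPSUN

open DiagRPThree DiagRPPolyakov

/-! ## Geometry of the witness on the even torus `L = 2c`, `c ≥ 3` -/

section Geometry

variable {L : ℕ}

/-- `θX = Y + 2e₀` for `X = (c-1, 0)`, `Y = (-2, c-1)`. -/
theorem bump_bump_colYe (c : ℕ) :
    bump plane02.1.1 (bump plane02.1.1 (colYe (L := L) c)) = (colXe (L := L) c).swap := by
  show bump 0 (bump 0 (colYe (L := L) c)) = (colXe (L := L) c).swap
  rw [bump_zero, bump_zero]
  refine Prod.ext ?_ rfl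
  show (-2 : ZMod L) + 1 + 1 = 0
  ring

/-- `X = θY + 2e₁`. -/
theorem bump_bump_colYe_swap (c : ℕ) :
    bump plane12.1.1 (bump plane12.1.1 (colYe (L := L) c).swap) = colXe (L := L) c := by
  show bump 1 (bump 1 (colYe (L := L) c).swap) = colXe (L := L) c
  rw [bump_one, bump_one]
  refine Prod.ext rfl ?_
  show (-2 : ZMod L) + 1 + 1 = 0
  ring

/-- The residues `c-2, …, c+2` are non-zero on the even torus `L = 2c`, `c ≥ 3`. -/
theorem residues_ne_zero (c : ℕ) (hL : L = 2 * c) (hc : 3 ≤ c) :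
    (c : ZMod L) ≠ 0 ∧ (c : ZMod L) - 1 ≠ 0 ∧ (c : ZMod L) - 2 ≠ 0 ∧ (c : ZMod L) + 1 ≠ 0 ∧
      (c : ZMod L) + 2 ≠ 0 := by
  refine ⟨coe_ne_zero_even c hL (by omega) (by omega), ?_, ?_, ?_, ?_⟩
  · have h := coe_ne_zero_even (L := L) c hL (k := c - 1) (by omega) (by omega)
    rwa [Nat.cast_sub (by omega), Nat.cast_one] at h
  · have h := coe_ne_zero_even (L := L) c hL (k := c - 2) (by omega) (by omega)
    rwa [Nat.cast_sub (by omega), Nat.cast_ofNat] at h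
  · have h := coe_ne_zero_even (L := L) c hL (k := c + 1) (by omega) (by omega)
    rwa [Nat.cast_add, Nat.cast_one] at h
  · have h := coe_ne_zero_even (L := L) c hL (k := c + 2) (by omega) (by omega)
    rwa [Nat.cast_add, Nat.cast_ofNat] at h

/-- The diagonal pair `(θX, X)` is separated: `θX - X = (1-c, c-1)`. -/
theorem sep_colXe (c : ℕ) (hL : L = 2 * c) (hc : 3 ≤ c) : Sep (colXe (L := L) c).swap (colXe c) := by
  obtain ⟨h0, h1, h2, -, -⟩ := residues_ne_zero c hL hc
  simp only [Sep, colXe, Prod.fst_swap, Prod.snd_swap]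
  refine ⟨⟨fun h => h1 ?_, fun h => h0 ?_, fun h => h2 ?_⟩, ⟨fun h => h1 ?_, fun h => h2 ?_, fun h => h0 ?_⟩⟩
  · linear_combination -h
  · linear_combination -h
  · linear_combination -h
  · linear_combination h
  · linear_combination h
  · linear_combination h

/-- The diagonal pair `(θY, Y)` is separated: `θY - Y = (c+1, -(c+1))`. -/
theorem sep_colYe (c : ℕ) (hL : L = 2 * c) (hc : 3 ≤ c) : Sep (colYe (L := L) c).swap (colYe c) := by
  obtain ⟨h0, -, -, h1, h2⟩ := residues_ne_zero c hL hc
  simp only [Sep, colYe, Prod.fst_swap, Prod.snd_swap]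
  refine ⟨⟨fun h => h1 ?_, fun h => h0 ?_, fun h => h2 ?_⟩, ⟨fun h => h1 ?_, fun h => h2 ?_, fun h => h0 ?_⟩⟩
  · linear_combination h
  · linear_combination h
  · linear_combination h
  · linear_combination -h
  · linear_combination -h
  · linear_combination -h

end Geometry

/-! ## The even torus: the two cross bands dominate -/

section Even

variable {L : ℕ} [NeZero L] {N : ℕ} {G : Type*} [Group G] [TopologicalSpace G]
  [IsTopologicalGroup G] [CompactSpace G] [MeasurableSpace G] [BorelSpace G]
  [SecondCountableTopology G] (ρ : G →* Matrix (Fin N) (Fin N) ℂ)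

/-- **The RP form is dominated by the two cross bands.** On the even torus `L = 2c ≥ 6`, with
`X = (c-1, 0)`, `Y = (-2, c-1)`: for `ρ z₀ = ω • 1`, `ω ≠ 1`, `0 ≤ β`, `2βN ≤ 1`,
`RP form ≤ -β^{2L} (J₁ + J₂) + C β^{2L+1}`, `J₁`, `J₂` the band integrals of the cross pairs and
`C = 4·2^P N² (2N)^{2L+1} + 2 N² 2^{2L} N^{2L+1}`, `P` the number of plaquettes. -/
theorem rpForm_le_even (hρ : Continuous ρ) {z₀ : G} {ω : ℂ}
    (hz₀ : ρ z₀ = ω • (1 : Matrix (Fin N) (Fin N) ℂ)) (hω : ω ≠ 1) (c : ℕ) (hL : L = 2 * c)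
    (hc : 3 ≤ c) {β : ℝ} (hβ : 0 ≤ β) (hγ : 2 * β * N ≤ 1) :
    rpForm ρ β (colXe (L := L) c) (colYe c) ≤
      -(β ^ (2 * L) * (bandIntegral ρ plane02 (colYe (L := L) c) +
          bandIntegral ρ plane12 (colYe (L := L) c).swap)) +
        β ^ (2 * L + 1) * (4 * 2 ^ Fintype.card (Plaquette 3 L) * N ^ 2 * (2 * N) ^ (2 * L + 1) +
          2 * N ^ 2 * 2 ^ (2 * L) * N ^ (2 * L + 1)) := by
  have hL5 : 5 ≤ L := by omega
  have hL1 : 1 < L := by omega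
  have hβN : β * N ≤ 1 := by nlinarith [mul_nonneg hβ (Nat.cast_nonneg N : (0 : ℝ) ≤ N)]
  set P : ℕ := Fintype.card (Plaquette 3 L) with hP
  set γ : ℝ := 2 * β * N with hγdef
  have hγ0 : 0 ≤ γ := by positivity
  set E : ℝ := N ^ 2 * (2 ^ (2 * L) * (β * N) ^ (2 * L + 1)) with hE
  set D : ℝ := N ^ 2 * γ ^ (2 * L + 1) with hD
  -- the four sums
  set PS := (univ : Finset (Plaquette 3 L)).powerset with hPS
  have hPScard : (PS.card : ℝ) = 2 ^ P := by
    rw [hPS, card_powerset, card_univ, hP]; push_cast; ring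
  have hdiag : ∀ {A B : ZMod L × ZMod L}, Sep A B → |∑ S ∈ PS, pairTerm ρ β S A B| ≤ 2 ^ P * D := by
    intro A B hsep
    calc |∑ S ∈ PS, pairTerm ρ β S A B| ≤ ∑ S ∈ PS, |pairTerm ρ β S A B| := abs_sum_le_sum_abs _ _
      _ ≤ ∑ _S ∈ PS, D := sum_le_sum fun S _ =>
          abs_pairTerm_le_of_sep ρ β hρ hz₀ hω hβ hγ hL1 hsep S
      _ = 2 ^ P * D := by rw [sum_const, nsmul_eq_mul, hPScard]
  have hcross : ∀ (pl : {q : Fin 3 × Fin 3 // q.1 < q.2}) (hpl : pl.1.2 = 2) (B : ZMod L × ZMod L),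
      β ^ (2 * L) * bandIntegral ρ pl B - E - 2 ^ P * D ≤
        ∑ S ∈ PS, pairTerm ρ β S (bump pl.1.1 (bump pl.1.1 B)) B := by
    intro pl hpl B
    have hmem : band B pl ∈ PS := by rw [hPS, mem_powerset]; exact subset_univ _
    rw [← add_sum_erase PS _ hmem]
    have h1 : β ^ (2 * L) * bandIntegral ρ pl B - E ≤
        pairTerm ρ β (band B pl) (bump pl.1.1 (bump pl.1.1 B)) B := by
      have h := abs_pairTerm_band_sub_le ρ β hρ hβ hβN hL1 pl hpl B
      rw [abs_le] at h
      linarith [h.1]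
    have h2 : |∑ S ∈ PS.erase (band B pl), pairTerm ρ β S (bump pl.1.1 (bump pl.1.1 B)) B| ≤
        2 ^ P * D := by
      calc |∑ S ∈ PS.erase (band B pl), pairTerm ρ β S (bump pl.1.1 (bump pl.1.1 B)) B|
          ≤ ∑ S ∈ PS.erase (band B pl), |pairTerm ρ β S (bump pl.1.1 (bump pl.1.1 B)) B| :=
            abs_sum_le_sum_abs _ _
        _ ≤ ∑ _S ∈ PS.erase (band B pl), D := sum_le_sum fun S hS =>
            abs_pairTerm_le_of_ne_band ρ β hρ hz₀ hω hβ hγ hL5 pl hpl B (ne_of_mem_erase hS)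
        _ ≤ 2 ^ P * D := by
            rw [sum_const, nsmul_eq_mul]
            refine mul_le_mul_of_nonneg_right ?_ (by positivity)
            rw [← hPScard]
            exact_mod_cast card_le_card (erase_subset _ _)
    rw [abs_le] at h2
    linarith [h2.1]
  -- assemble
  rw [rpForm_eq_sum ρ β hρ, ← hPS]
  simp only [sum_add_distrib, sum_sub_distrib]
  have ha := hdiag (sep_colXe c hL hc)
  have hd := hdiag (sep_colYe c hL hc)
  have hb := hcross plane02 rfl (colYe c)
  rw [bump_bump_colYe] at hb
  have hc' := hcross plane12 rfl (colYe c).swap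
  rw [bump_bump_colYe_swap] at hc'
  have hcomm : ∑ S ∈ PS, pairTerm ρ β S (colYe (L := L) c).swap (colXe c) =
      ∑ S ∈ PS, pairTerm ρ β S (colXe (L := L) c) (colYe c).swap :=
    sum_congr rfl fun S _ => pairTerm_comm ρ β S _ _
  rw [abs_le] at ha hd
  have hγpow : γ ^ (2 * L + 1) = β ^ (2 * L + 1) * (2 * N) ^ (2 * L + 1) := by
    rw [hγdef, show 2 * β * (N : ℝ) = β * (2 * N) by ring, mul_pow]
  have hβNpow : (β * N) ^ (2 * L + 1) = β ^ (2 * L + 1) * N ^ (2 * L + 1) := mul_pow _ _ _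
  have hDE : 4 * (2 ^ P * D) + 2 * E = β ^ (2 * L + 1) * (4 * 2 ^ P * N ^ 2 * (2 * N) ^ (2 * L + 1) +
      2 * N ^ 2 * 2 ^ (2 * L) * N ^ (2 * L + 1)) := by
    rw [hD, hE, hγpow, hβNpow]; ring
  linarith [ha.2, hd.2, hb, hc', hcomm]

omit [NeZero L] [TopologicalSpace G] [IsTopologicalGroup G] [CompactSpace G] [MeasurableSpace G]
  [BorelSpace G] [SecondCountableTopology G] in
/-- `P_X - P_Y` (real) is an observable of the INNER diagonal half on the even torus `L = 2c`,
`c ≥ 3`: both columns `X = (c-1, 0)`, `Y = (-2, c-1)` lie at the level `c - 1 < c = L/2`. -/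
theorem isInnerHalfObservable_polReDiff_even (c : ℕ) (hL : L = 2 * c) (hc : 3 ≤ c) :
    IsInnerHalfObservable (0 : Fin 3) 1 fun U : GaugeConfig 3 L G =>
      ((polRe ρ 2 U (vsite (colXe (L := L) c) 0) - polRe ρ 2 U (vsite (colYe (L := L) c) 0) : ℝ) : ℂ) := by
  have hlev : ((c : ZMod L) - 1).val < L / 2 := by
    rw [show (c : ZMod L) - 1 = ((c - 1 : ℕ) : ZMod L) by rw [Nat.cast_sub (by omega), Nat.cast_one],
      ZMod.val_natCast, Nat.mod_eq_of_lt (by omega)]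
    omega
  have hY : (-2 : ZMod L) - ((c : ZMod L) - 1) = (c : ZMod L) - 1 := by
    have h : ((2 * c : ℕ) : ZMod L) = 0 := by rw [← hL, ZMod.natCast_self]
    push_cast at h
    linear_combination -h
  intro U V hUV
  have key : ∀ A : ZMod L × ZMod L, A.1 - A.2 = (c : ZMod L) - 1 →
      ∀ e : Edge 3 L, ccnt A e ≠ 0 → U e = V e := by
    intro A hA e he
    obtain ⟨h2, h0, h1⟩ := ccnt_ne_zero he
    refine hUV e ?_ ?_
    · rw [h0, h1, hA]
      exact hlev
    · rw [h2, WilsonRP.shift_apply_of_ne e.1 (show (0 : Fin 3) ≠ 2 by decide),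
        WilsonRP.shift_apply_of_ne e.1 (show (1 : Fin 3) ≠ 2 by decide), h0, h1, hA]
      exact hlev
  simp only [polRe_vsite_congr ρ (colXe c) (key (colXe c) (by simp [colXe])),
    polRe_vsite_congr ρ (colYe c) (key (colYe c) (by simpa [colYe] using hY))]

/-- ★ **Inner-half diagonal RP fails on even three-tori at small coupling, from the character
moments.** Let `G` be a compact metrisable group, `ρ` continuous with `N ≥ 1`, with a centre
element `ρ z₀ = ω • 1`, `ω ≠ 1`, and with the character identities
(R1) `∫ Re χ(x g⁻¹) Re χ(g y) dg = c₁ Re χ(x y)`, (R2) `∫ Re χ(g x g⁻¹ y) dg = c₂ Re(χ(x) χ(y))`,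
`c₁, c₂ > 0`. Then for every even `L ≥ 6` there is `β₀ > 0` such that
`¬ InnerDiagonalRP (d := 3) (L := L) ρ β 0 1` for all `0 < β ≤ β₀`. -/
theorem not_innerDiagonalRP_even_of_moments (hLeven : Even L) (h6 : 6 ≤ L)
    (hρ : Continuous ρ) (hN : 1 ≤ N) {z₀ : G} {ω : ℂ}
    (hz₀ : ρ z₀ = ω • (1 : Matrix (Fin N) (Fin N) ℂ)) (hω : ω ≠ 1) {c₁ c₂ : ℝ} (hc₁ : 0 < c₁)
    (hc₂ : 0 < c₂)
    (hR1 : ∀ x y : G, ∫ g, reTr ρ (x * g⁻¹) * reTr ρ (g * y) ∂haarProbability G =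
      c₁ * reTr ρ (x * y))
    (hR2 : ∀ x y : G, ∫ g, reTr ρ (g * x * g⁻¹ * y) ∂haarProbability G =
      c₂ * ((ρ x).trace * (ρ y).trace).re) :
    ∃ β₀ : ℝ, 0 < β₀ ∧ ∀ β : ℝ, 0 < β → β ≤ β₀ →
      ¬ InnerDiagonalRP (d := 3) (L := L) ρ β 0 1 := by
  obtain ⟨c, hc⟩ := hLeven
  have hL : L = 2 * c := by omega
  have hc3 : 3 ≤ c := by omega
  have hL3 : 3 ≤ L := by omega
  set I₁ := bandIntegral ρ plane02 (colYe (L := L) c) with hI₁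
  set I₂ := bandIntegral ρ plane12 (colYe (L := L) c).swap with hI₂
  have hI₁pos : 0 < I₁ := bandIntegral_pos ρ plane02 _ hρ hL3 rfl hN hc₁ hc₂ hR1 hR2
  have hI₂pos : 0 < I₂ := bandIntegral_pos ρ plane12 _ hρ hL3 rfl hN hc₁ hc₂ hR1 hR2
  set C : ℝ := 4 * 2 ^ Fintype.card (Plaquette 3 L) * N ^ 2 * (2 * N) ^ (2 * L + 1) +
    2 * N ^ 2 * 2 ^ (2 * L) * N ^ (2 * L + 1) with hC
  have hNpos : (0 : ℝ) < N := by exact_mod_cast hN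
  have hCpos : 0 < C := by positivity
  refine ⟨min (1 / (2 * N)) ((I₁ + I₂) / (2 * C)), lt_min (by positivity) (by positivity),
    fun β hβ hβ0 hRP => ?_⟩
  have hγ : 2 * β * N ≤ 1 := by
    have h := (le_min_iff.1 hβ0).1
    rw [le_div_iff₀ (by positivity)] at h
    linarith
  have hβC : β * C < I₁ + I₂ := by
    have h := (le_min_iff.1 hβ0).2
    rw [le_div_iff₀ (by positivity)] at h
    linarith
  -- the RP form is negative
  have hneg : rpForm ρ β (colXe (L := L) c) (colYe c) < 0 := by
    have h := rpForm_le_even ρ hρ hz₀ hω c hL hc3 hβ.le hγ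
    have hpow : 0 < β ^ (2 * L) := pow_pos hβ _
    have : -(β ^ (2 * L) * (I₁ + I₂)) + β ^ (2 * L + 1) * C =
        -(β ^ (2 * L) * ((I₁ + I₂) - β * C)) := by ring
    rw [← hI₁, ← hI₂, ← hC, this] at h
    nlinarith [mul_pos hpow (sub_pos.2 hβC)]
  -- but inner-half diagonal RP would make it non-negative
  have hF := hRP (fun U : GaugeConfig 3 L G =>
      ((polRe ρ 2 U (vsite (colXe (L := L) c) 0) - polRe ρ 2 U (vsite (colYe (L := L) c) 0) : ℝ) : ℂ))
    (Complex.measurable_ofReal.comp ((continuous_polRe ρ hρ 2 _).sub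
      (continuous_polRe ρ hρ 2 _)).measurable)
    ⟨N + N, fun U => by
      rw [Complex.norm_real, Real.norm_eq_abs]
      exact (abs_sub _ _).trans (add_le_add (abs_polRe_le ρ hρ 2 U _) (abs_polRe_le ρ hρ 2 U _))⟩
    (isInnerHalfObservable_polReDiff_even ρ c hL hc3)
  rw [wilsonExpectation_witness_eq ρ hρ, Complex.zero_le_real] at hF
  obtain ⟨hZ0, hZtop⟩ := partitionFunction_ne_zero_ne_top (d := 3) (L := L) ρ hρ β
  have hZ : 0 < ((partitionFunction (d := 3) (L := L) ρ β)⁻¹).toReal :=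
    ENNReal.toReal_pos (ENNReal.inv_ne_zero.2 hZtop) (ENNReal.inv_ne_top.2 hZ0)
  have hpos : 0 < ((partitionFunction (d := 3) (L := L) ρ β)⁻¹).toReal *
      (Real.exp (-(β * (N * Fintype.card (Plaquette 3 L)))) *
        -rpForm ρ β (colXe (L := L) c) (colYe c)) :=
    mul_pos hZ (mul_pos (Real.exp_pos _) (neg_pos.2 hneg))
  linarith

/-- ★★ **Inner-half diagonal RP fails on every even three-torus `L ≥ 6` for `G ≅ SU(N)` at
small coupling.** For every compact metrisable group `G ≅ SU(N)` (`IsSpecialUnitaryModel ρ`,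
`N ≥ 2`) and every even `L ≥ 6` there is `β₀ > 0` (depending on `L`, `N`) with
`¬ InnerDiagonalRP (d := 3) (L := L) ρ β 0 1` for all `0 < β ≤ β₀`: the inner-half diagonal RP
of even tori, true on every even TWO-torus `L ≥ 4` (L3(η)) and the input of the two-dimensional
Class-B transfer (L3(ι)), is false on even THREE-tori for the venture's own gauge groups. -/
theorem not_innerDiagonalRP_even_specialUnitary (hρ : IsSpecialUnitaryModel ρ) (hN : 2 ≤ N)
    (hLeven : Even L) (h6 : 6 ≤ L) :
    ∃ β₀ : ℝ, 0 < β₀ ∧ ∀ β : ℝ, 0 < β → β ≤ β₀ →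
      ¬ InnerDiagonalRP (d := 3) (L := L) ρ β 0 1 := by
  obtain ⟨z₀, ω, hω, hz₀⟩ := exists_smul_one ρ hρ hN
  obtain ⟨c₁, hc₁, hR1⟩ := exists_re_conv_const ρ hρ hN
  have hNpos : (0 : ℝ) < N := by exact_mod_cast (show 0 < N by omega)
  exact not_innerDiagonalRP_even_of_moments ρ hLeven h6 hρ.1 (by omega) hz₀ hω hc₁
    (inv_pos.2 hNpos) hR1 (integral_re_trace_conj_mul ρ hρ)

/-- The back-gauge-invariant closed-half statement fails as well (it implies the inner-half one). -/
theorem not_backInvariantDiagonalRP_even_specialUnitary (hρ : IsSpecialUnitaryModel ρ) (hN : 2 ≤ N)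
    (hLeven : Even L) (h6 : 6 ≤ L) :
    ∃ β₀ : ℝ, 0 < β₀ ∧ ∀ β : ℝ, 0 < β → β ≤ β₀ →
      ¬ BackInvariantDiagonalRP (d := 3) (L := L) ρ β 0 1 := by
  obtain ⟨β₀, hβ₀, h⟩ := not_innerDiagonalRP_even_specialUnitary ρ hρ hN hLeven h6
  exact ⟨β₀, hβ₀, fun β hβ hβ1 hB => h β hβ hβ1 hB.innerDiagonalRP⟩

end Even

/-! ## The concrete groups `SU(N)` -/

section SUN

open Literature.MathematicalPhysics.QuantumLattice

/-- ★★ **`SU(N)` lattice gauge theory (`N ≥ 2`: `SU(2)`, `SU(3)`, …) violates inner-half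
diagonal RP on every even three-torus `(ℤ/L)³`, `L ≥ 6`, for all sufficiently small `β > 0`**:
the theorem `not_innerDiagonalRP_even_specialUnitary` for the defining representation of
`Matrix.specialUnitaryGroup (Fin N) ℂ` (not vacuous). -/
theorem not_innerDiagonalRP_even_suN {L N : ℕ} [NeZero L] (hN : 2 ≤ N) (hLeven : Even L)
    (h6 : 6 ≤ L) :
    ∃ β₀ : ℝ, 0 < β₀ ∧ ∀ β : ℝ, 0 < β → β ≤ β₀ →
      ¬ InnerDiagonalRP (d := 3) (L := L) (fundamentalRep (Fin N)) β 0 1 := by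
  haveI : SecondCountableTopology (Matrix (Fin N) (Fin N) ℂ) :=
    inferInstanceAs (SecondCountableTopology (Fin N → Fin N → ℂ))
  haveI : SecondCountableTopology (Matrix.specialUnitaryGroup (Fin N) ℂ) :=
    Topology.IsEmbedding.subtypeVal.secondCountableTopology
  exact not_innerDiagonalRP_even_specialUnitary (fundamentalRep (Fin N))
    (TorusAreaLaw.isSpecialUnitaryModel_fundamentalRep N) hN hLeven h6

/-- **`SU(N)` violates the back-gauge-invariant closed-half diagonal RP on every even three-torus
`L ≥ 6` at small coupling** (the form of diagonal RP that survives the back-layer obstruction of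
`not_diagonalReflectionPositive`). -/
theorem not_backInvariantDiagonalRP_even_suN {L N : ℕ} [NeZero L] (hN : 2 ≤ N) (hLeven : Even L)
    (h6 : 6 ≤ L) :
    ∃ β₀ : ℝ, 0 < β₀ ∧ ∀ β : ℝ, 0 < β → β ≤ β₀ →
      ¬ BackInvariantDiagonalRP (d := 3) (L := L) (fundamentalRep (Fin N)) β 0 1 := by
  obtain ⟨β₀, hβ₀, h⟩ := not_innerDiagonalRP_even_suN (L := L) hN hLeven h6
  exact ⟨β₀, hβ₀, fun β hβ hβ1 hB => h β hβ hβ1 hB.innerDiagonalRP⟩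

end SUN

end DiagRPSUN

end

end Summit.QuantumFields.GaugeBoot
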